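/-
Copyright (c) 2026. All rights reserved.
Released under Apache 2.0 license as described in the file LICENSE.
-/
import Summits.HubbardSuperconductivity.HubbardLadder.Bounds.SectorTwistRatio
import Summits.HubbardSuperconductivity.HubbardLadder.Bounds.SectorTransferEnvelope
import Literature.MathematicalPhysics.QuantumLattice.GibbsSectorWeightTransfer
import Literature.MathematicalPhysics.QuantumLattice.HubbardCommutatorBound
import Literature.MathematicalPhysics.QuantumLattice.TorusDiagOutwardNeighbours
import HarnessLib

/-!
# Theorem 13_N with the walk input discharged by commutator bounds (bounds.tex §13)

HONEST FRAMING: ladder R1–R4 with certified numbers; no claim on H/H₀. These are bounds for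
MODEL CLASSES (the typed repulsive/attractive `t–t'` Hubbard torus with a flux twist), no
materials claim.

This part DISCHARGES the walk hypotheses `hG`, `hadj` of the conditional assembly
`SectorTwistRatio.norm_ttSectorZ_twist_sub_le` (#211.8) UNCONDITIONALLY IN THE MODEL, for every
`β ≥ 0`, with explicit constants and no separation condition:

1. `card_filter_fermionTorusDiagGraph_adj_le`: every site of `Λ_L` has at most `4` next-nearest
   (diagonal) neighbours (from the tree's `card_filter_torusDiagGraph_adj_le`).
2. `norm_commutator_hubbardTorusTT'Flux_zero_{annihilation,creation}_le`: the volume-uniform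
   commutator bounds `‖[H^{tt'}_L(0), c_o]‖, ‖[H^{tt'}_L(0), c†_o]‖ ≤ r(t',U)`,
   `r = 18 (2 + |U| + 2|t'|)` (`ttCommRate`), from the tree's
   `norm_commutator_hamiltonianWith_{annihilation,creation}_le` applied to the nearest-neighbour
   part (`t = 1`, degree `4`) and the diagonal part (`t'`, degree `4`) of
   `H^{tt'}_L = hubbardTorusTT' L 1 t' U`.
3. `ttSectorWeight_transfer`: the two-sided LOG-LIPSCHITZ continuity of the untwisted sector
   weights `w_k = Re Z_k(0)`: `(n-k) w_k ≤ e^{βnr/(n-k)} (k+1) w_{k+1}` and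
   `(k+1) w_{k+1} ≤ e^{βnr/(k+1)} (n-k) w_k` (`n = |Orb Λ_L| = 2L²`, `k < n`) — the tree's
   `sectorWeight_orbitSum_transfer` (orbit-sum trial vectors + Jensen; Ruelle 1969 §3.4,
   Bratteli–Robinson II §5.3) at `K = H^{tt'}_L(0)`.
4. `norm_ttSectorZ_twist_sub_le_of_commutator`: #211.8 ∘ `walk_input_of_transfer` (#211.17) ∘ 3:
   THEOREM 13_N with the walk constant `C = transferWalkConstant n N K_w (β n r) s` in place of the
   hypothesised `e^{G}`; the ONLY remaining hypotheses are the numerator's (Kotecký–Preiss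
   smallness on the fugacity circle, atomic non-vanishing — high temperature) and the Chebyshev
   window data (`gcVar ≤ V < K²`, `|gcMean - N| ≤ K₀`, `K₀ + 4K + 2 ≤ K_w ≤ N`, `N + K_w ≤ n`), for
   which #211.7/#211.11 supply `K₀ = 0` at the centred `s` and a certified `V`.

QUANTITATIVE CAVEAT (stated on page 1, not hidden): `log C ≈ 2βr/ρ + 2βr/(2-ρ) + O(K_w/(ρL²))`
is volume-independent but the walk factor is `C^{2K_w}` with `K_w ≳ 4K ~ √V ~ L`, i.e.
`e^{O(βr) L}`; it is beaten by the numerator's `e^{-δL}` only when `βr` is small against `δ` —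
a HIGH-TEMPERATURE condition made explicit by whoever instantiates the constants (D5), never an
assumption on `L`. No numerics, no `native_decide`; standard axioms only.
References: D. Ruelle, Statistical Mechanics (1969) §3.4 [Ruelle1969]; O. Bratteli,
D. W. Robinson, Operator Algebras and Quantum Statistical Mechanics II, §5.3 [BratteliRobinson2];
R. Kotecký, D. Preiss, Comm. Math. Phys. 103 (1986) 491 [KoteckyPreiss1986]; programme notes
bounds.tex §13.
-/

noncomputable section

namespace Summit.HubbardSuperconductivity.HubbardLadder.Bounds

open Matrix Finset Complex
open Literature.MathematicalPhysics.QuantumLattice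
open Literature.MathematicalPhysics.QuantumLattice.HubbardWave0
open Summit.HubbardSuperconductivity.HubbardSuperconductivity.Theorems.WidthHaldane
open scoped Matrix.Norms.L2Operator ComplexOrder

variable {L : ℕ} [NeZero L]

/-! ### Degree and commutator bounds for `H^{tt'}_L` -/

/-- Every site of the fermion torus `Λ_L` has at most `4` diagonal (next-nearest) neighbours.
[cite: XuEtAl2024, eq. (1); from `card_filter_torusDiagGraph_adj_le`] -/
theorem card_filter_fermionTorusDiagGraph_adj_le (u : FermionTorus 2 L) :
    (Finset.univ.filter fun v => (fermionTorusDiagGraph L).Adj u v).card ≤ 4 := by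
  classical
  calc (Finset.univ.filter fun v => (fermionTorusDiagGraph L).Adj u v).card
      = ((Finset.univ.filter fun v => (fermionTorusDiagGraph L).Adj u v).image
          FermionTorus.toTorusSite).card :=
        (card_image_of_injective _ FermionTorus.equivTorusSite.injective).symm
    _ ≤ (Finset.univ.filter fun w => (torusDiagGraph L).Adj u.toTorusSite w).card := by
        refine card_le_card fun z hz => ?_
        obtain ⟨v, hv, rfl⟩ := mem_image.1 hz
        exact mem_filter.2 ⟨mem_univ _, (fermionTorusDiagGraph_adj u v).1 (mem_filter.1 hv).2⟩
    _ ≤ 4 := card_filter_torusDiagGraph_adj_le _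

/-- The volume-uniform commutator rate `r(t', U) = 18 (2 + |U| + 2|t'|)` of `H^{tt'}_L`
(`9 = 2·4+1` orbitals touched per site, hopping `1` and `t'`, interaction `U`).
[programme definition: bounds.tex §13, Lemma 13.5′] -/
def ttCommRate (t' U : ℝ) : ℝ := 18 * (2 + |U| + 2 * |t'|)

/-- `0 ≤ r(t', U)`. [this file] -/
theorem ttCommRate_nonneg (t' U : ℝ) : 0 ≤ ttCommRate t' U := by
  unfold ttCommRate; positivity

omit [NeZero L] in
/-- The commutator of `H^{tt'}_L = H(1,U) + H'(t',0)` with `c` splits into the two graph parts.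
[this file] -/
theorem hubbardTorusTT'_commutator_split (t' U : ℝ)
    (c : Matrix (Finset (Orb (FermionTorus 2 L))) (Finset (Orb (FermionTorus 2 L))) ℂ) :
    hubbardTorusTT' L 1 t' U * c - c * hubbardTorusTT' L 1 t' U =
      (hamiltonianWith (fermionTorusGraph 2 L) 1 U 0 * c -
          c * hamiltonianWith (fermionTorusGraph 2 L) 1 U 0) +
        (hamiltonianWith (fermionTorusDiagGraph L) t' 0 0 * c -
          c * hamiltonianWith (fermionTorusDiagGraph L) t' 0 0) := by
  rw [hamiltonianWith_zero, hamiltonianWith_zero, hubbardTorusTT', add_mul, mul_add]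
  abel

/-- **`‖[H^{tt'}_L(0), c_o]‖ ≤ 18 (2 + |U| + 2|t'|)`** for every orbital `o` and every `L`.
[folklore; from `norm_commutator_hamiltonianWith_annihilation_le`] -/
theorem norm_commutator_hubbardTorusTT'Flux_zero_annihilation_le (t' U : ℝ)
    (o : Orb (FermionTorus 2 L)) :
    ‖hubbardTorusTT'Flux L t' U 0 * annihilation o -
        annihilation o * hubbardTorusTT'Flux L t' U 0‖ ≤ ttCommRate t' U := by
  have h1 := norm_commutator_hamiltonianWith_annihilation_le (fermionTorusGraph 2 L) (Δ := 4)
    (fun x => SourceGas.card_filter_fermionTorusGraph_adj_le x) 1 U 0 (ofLex o).1 (ofLex o).2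
  have h2 := norm_commutator_hamiltonianWith_annihilation_le (fermionTorusDiagGraph L) (Δ := 4)
    (fun x => card_filter_fermionTorusDiagGraph_adj_le x) t' 0 0 (ofLex o).1 (ofLex o).2
  rw [hubbardTorusTT'Flux_zero, hubbardTorusTT'_commutator_split]
  refine (norm_add_le _ _).trans ((add_le_add h1 h2).trans (le_of_eq ?_))
  unfold ttCommRate
  norm_num
  ring

/-- **`‖[H^{tt'}_L(0), c†_o]‖ ≤ 18 (2 + |U| + 2|t'|)`** for every orbital `o` and every `L`.
[folklore; from `norm_commutator_hamiltonianWith_creation_le`] -/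
theorem norm_commutator_hubbardTorusTT'Flux_zero_creation_le (t' U : ℝ)
    (o : Orb (FermionTorus 2 L)) :
    ‖hubbardTorusTT'Flux L t' U 0 * creation o - creation o * hubbardTorusTT'Flux L t' U 0‖ ≤
      ttCommRate t' U := by
  have h1 := norm_commutator_hamiltonianWith_creation_le (fermionTorusGraph 2 L) (Δ := 4)
    (fun x => SourceGas.card_filter_fermionTorusGraph_adj_le x) 1 U 0 (ofLex o).1 (ofLex o).2
  have h2 := norm_commutator_hamiltonianWith_creation_le (fermionTorusDiagGraph L) (Δ := 4)
    (fun x => card_filter_fermionTorusDiagGraph_adj_le x) t' 0 0 (ofLex o).1 (ofLex o).2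
  rw [hubbardTorusTT'Flux_zero, hubbardTorusTT'_commutator_split]
  refine (norm_add_le _ _).trans ((add_le_add h1 h2).trans (le_of_eq ?_))
  unfold ttCommRate
  norm_num
  ring

/-! ### Log-Lipschitz continuity of the sector weights -/

/-- **LOG-LIPSCHITZ CONTINUITY OF `k ↦ w_k`** (`w_k = Re Z_k(0)`, `n = |Orb Λ_L|`, `k < n`,
`β ≥ 0`, `r = ttCommRate t' U`):
`(n - k) w_k ≤ e^{βnr/(n-k)} (k+1) w_{k+1}` and `(k+1) w_{k+1} ≤ e^{βnr/(k+1)} (n - k) w_k`.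
[Ruelle1969 §3.4; BratteliRobinson2 §5.3; from `sectorWeight_orbitSum_transfer`] -/
theorem ttSectorWeight_transfer {β : ℝ} (hβ : 0 ≤ β) (t' U : ℝ) (k : ℕ)
    (hk : k < Fintype.card (Orb (FermionTorus 2 L))) :
    ((Fintype.card (Orb (FermionTorus 2 L)) : ℝ) - k) * ttSectorWeight L β t' U k ≤
        Real.exp (β * (Fintype.card (Orb (FermionTorus 2 L)) * ttCommRate t' U) /
            ((Fintype.card (Orb (FermionTorus 2 L)) : ℝ) - k)) *
          (((k : ℝ) + 1) * ttSectorWeight L β t' U (k + 1)) ∧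
      ((k : ℝ) + 1) * ttSectorWeight L β t' U (k + 1) ≤
        Real.exp (β * (Fintype.card (Orb (FermionTorus 2 L)) * ttCommRate t' U) / ((k : ℝ) + 1)) *
          (((Fintype.card (Orb (FermionTorus 2 L)) : ℝ) - k) * ttSectorWeight L β t' U k) := by
  have hw : ∀ m : ℕ,
      ∑ s ∈ (Finset.univ.filter fun s : Finset (Orb (FermionTorus 2 L)) => s.card = m),
        (gibbsWeight β (hubbardTorusTT'Flux L t' U 0) s s).re = ttSectorWeight L β t' U m := by
    intro m
    rw [ttSectorWeight, ttSectorZ_eq_sum, Complex.re_sum]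
  have h := sectorWeight_orbitSum_transfer (hubbardTorusTT'Flux L t' U 0)
    (isHermitian_hubbardTorusTT'Flux L t' U 0)
    (card_eq_of_preservesSectors (preservesSectors_hubbardTorusTT'Flux L t' U 0)) hβ
    (norm_commutator_hubbardTorusTT'Flux_zero_creation_le t' U)
    (norm_commutator_hubbardTorusTT'Flux_zero_annihilation_le t' U) k hk
  rwa [hw, hw] at h

/-- THE WALK INPUT OF #211.8 IN THE MODEL (`hG`, `hadj` with `G = log C`,
`C = transferWalkConstant n N K_w (β n r) s`), for every `β ≥ 0`, from the Chebyshev window data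
alone. [this file: `walk_input_of_transfer` ∘ `ttSectorWeight_transfer`] -/
theorem tt_walk_input {β : ℝ} (hβ : 0 ≤ β) (t' U s : ℝ) {K K₀ : ℝ} (hK : 0 < K)
    (hV : gcVar (ttSectorWeight L β t' U) (Fintype.card (Orb (FermionTorus 2 L))) s ≤ K ^ 2 / 4)
    {N Kw : ℕ}
    (hm : |gcMean (ttSectorWeight L β t' U) (Fintype.card (Orb (FermionTorus 2 L))) s - N| ≤ K₀)
    (hKw : K₀ + 2 * K + 2 ≤ Kw) (hKwN : Kw ≤ N)
    (hNn : N + Kw ≤ Fintype.card (Orb (FermionTorus 2 L))) :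
    0 ≤ Real.log (transferWalkConstant (Fintype.card (Orb (FermionTorus 2 L))) N Kw
        (β * (Fintype.card (Orb (FermionTorus 2 L)) * ttCommRate t' U)) s) ∧
      ∀ k : ℕ, N - Kw ≤ k → k + 1 ≤ min (N + Kw) (Fintype.card (Orb (FermionTorus 2 L))) →
        Real.exp (s * (k + 1 : ℕ)) * ttSectorWeight L β t' U (k + 1) ≤
            Real.exp (Real.log (transferWalkConstant (Fintype.card (Orb (FermionTorus 2 L))) N Kw
              (β * (Fintype.card (Orb (FermionTorus 2 L)) * ttCommRate t' U)) s)) *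
              (Real.exp (s * k) * ttSectorWeight L β t' U k) ∧
          Real.exp (s * k) * ttSectorWeight L β t' U k ≤
            Real.exp (Real.log (transferWalkConstant (Fintype.card (Orb (FermionTorus 2 L))) N Kw
              (β * (Fintype.card (Orb (FermionTorus 2 L)) * ttCommRate t' U)) s)) *
              (Real.exp (s * (k + 1 : ℕ)) * ttSectorWeight L β t' U (k + 1)) := by
  have hw : ∀ k ≤ Fintype.card (Orb (FermionTorus 2 L)), 0 < ttSectorWeight L β t' U k :=
    fun k hk => ttSectorWeight_pos β t' U hk
  have hb : 0 ≤ β * (Fintype.card (Orb (FermionTorus 2 L)) * ttCommRate t' U) :=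
    mul_nonneg hβ (mul_nonneg (Nat.cast_nonneg _) (ttCommRate_nonneg t' U))
  exact walk_input_of_transfer hw s hK hV hb
    (fun k hk => ttSectorWeight_transfer hβ t' U k (by omega)) hm hKw hKwN hNn

/-! ### Theorem 13_N with the walk discharged -/

/-- **THEOREM 13_N, WALK DISCHARGED.** For the block `#s = N` of the `t–t'` Hubbard torus with
flux twist `θ` at inverse temperature `β > 0`: under the numerator hypotheses of #211.8
(Kotecký–Preiss smallness on the fugacity circle `|z| = e^{s}`, atomic non-vanishing) and the
Chebyshev-window data (`1 ≤ K`, `gcVar ≤ V < K²`, `|gcMean - N| ≤ K₀`, `K₀ + 4K + 2 ≤ K_w ≤ N`,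
`N + K_w ≤ n`, `n = |Orb Λ_L|`):
`‖Z_N(θ) - Z_N(0)‖ ≤ (2K+1) C^{2K_w} / (1 - V/K²) · ((e^{2aL²e^{-δL}} - 1) + 2 z^{|Λ|} e^{(F -
e^{κ} - κ)|Λ|} / Ξ(s)) · Re Z_N(0)` with the EXPLICIT
`C = transferWalkConstant n N K_w (β n r(t',U)) s`, `r = 18 (2 + |U| + 2|t'|)`. The walk hypotheses
`hG`, `hadj` of #211.8 are DISCHARGED by commutator bounds (no dressing series, no separation
condition). See the module docstring for the size of `C^{2K_w}` (high temperature needed to beat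
`e^{-δL}`). [programme: bounds.tex §13 Theorem 13_N; Ruelle1969 §3.4; this file] -/
theorem norm_ttSectorZ_twist_sub_le_of_commutator (hL : 3 ≤ L) {β : ℝ} (hβ : 0 < β) (t' U θ : ℝ)
    {M N : ℕ} (hM : Fintype.card (Orb (FermionTorus 2 L)) < M) (hN : N < M) (s : ℝ)
    (hz : ∀ k ∈ Finset.range M,
      atomicPartitionFn (β : ℂ) (U : ℂ) (fourierPoint M (s : ℂ) k / β) ≠ 0)
    {c₀ u₀ R a δ F : ℝ} (hc₀ : 0 ≤ c₀) (hc1 : c₀ ≤ 1) (hv : |β * U| ≤ u₀) (hR : 0 < R)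
    (hfloor : 1 ≤ R ^ 2 * (1 - (1 - c₀) / 2 - (1 - c₀ ^ 2) / (1 + Real.exp (-(u₀ / 2))) ^ 2))
    (ha : 0 < a) (hδ : 0 < δ)
    (hsmall : 16 * (|β| * (1 + |t'|)) * Real.exp (2 * (|β| * (1 + |t'|))) *
      (R * Real.exp (a + δ) + a) ^ 2 ≤ a)
    (hF : Real.exp (offArcRate c₀ u₀ (β * U) s) +
      16 * (|β| * (1 + |t'|)) * Real.exp (2 * (|β| * (1 + |t'|))) * F ^ 2 ≤ F)
    {K V K₀ : ℝ} {Kw : ℕ} (hK : 1 ≤ K)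
    (hV : gcVar (ttSectorWeight L β t' U) (Fintype.card (Orb (FermionTorus 2 L))) s ≤ V)
    (hVK : V < K ^ 2)
    (hm : |gcMean (ttSectorWeight L β t' U) (Fintype.card (Orb (FermionTorus 2 L))) s - N| ≤ K₀)
    (hKw : K₀ + 4 * K + 2 ≤ Kw) (hKwN : Kw ≤ N)
    (hNKw : N + Kw ≤ Fintype.card (Orb (FermionTorus 2 L))) :
    ‖ttSectorZ L β t' U θ N - ttSectorZ L β t' U 0 N‖ ≤
      (2 * K + 1) *
            transferWalkConstant (Fintype.card (Orb (FermionTorus 2 L))) N Kw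
                (β * (Fintype.card (Orb (FermionTorus 2 L)) * ttCommRate t' U)) s ^ (2 * Kw) /
          (1 - V / K ^ 2) *
        ((Real.exp (2 * a * (L : ℝ) ^ 2 * Real.exp (-(δ * L))) - 1) +
          2 * (atomicZ (β * U) s ^ Fintype.card (FermionTorus 2 L) *
            Real.exp ((F - Real.exp (offArcRate c₀ u₀ (β * U) s) - offArcRate c₀ u₀ (β * U) s) *
              Fintype.card (FermionTorus 2 L))) /
            gcSum (ttSectorWeight L β t' U) (Fintype.card (Orb (FermionTorus 2 L))) s) *
        (ttSectorZ L β t' U 0 N).re := by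
  -- the window reduction with `K' = 2K`
  have hK' : (0 : ℝ) < 2 * K := by linarith
  have hV' : gcVar (ttSectorWeight L β t' U) (Fintype.card (Orb (FermionTorus 2 L))) s ≤
      (2 * K) ^ 2 / 4 := by nlinarith
  have hKw' : K₀ + 2 * (2 * K) + 2 ≤ Kw := by linarith
  obtain ⟨hG, hadj⟩ := tt_walk_input hβ.le t' U s hK' hV' hm hKw' hKwN hNKw
  -- the conditional assembly (#211.8)
  have h := norm_ttSectorZ_twist_sub_le hL hβ.ne' t' U θ hM hN (by omega) s hz hc₀ hc1 hv hR
    hfloor ha hδ hsmall hF hK hV hVK hm (by linarith) hG hadj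
  have hKw1 : 1 ≤ Kw := by
    have hK₀ : 0 ≤ K₀ := (abs_nonneg _).trans hm
    have : (1 : ℝ) ≤ Kw := by linarith
    exact_mod_cast this
  rwa [Real.exp_log (transferWalkConstant_pos _ s hKw1 hNKw)] at h

end Summit.HubbardSuperconductivity.HubbardLadder.Bounds
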